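import Summits.ABC.ABC.Theorems.PrimePowerRadical.Negative.Orders
import Summits.ABC.ABC.Theorems.PrimePowerRadical.Negative.DoubleWall
import Summits.ABC.ABC.Theorems.PrimePowerRadical.Negative.LinearLoss

/-!
# `PrimePowerRadical` at a prime `q` forces the renormalised Brjuno atoms to tend to `0`

Stub `stub_atom_tendsto_zero` of the line `Sketch` (card `adelic-brjuno-summability`, crux stmt-ABC-1648):
the NECESSARY direction of the sandwich `(c_p)_p ∈ c₀ ⟸ crux(q) ⟸ (c_p)_p ∈ ℓ¹`.

With `W_p := wieferichLevel q p`, `d_p := ordMod q p` and the renormalised `p`-adic Brjuno atom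
`c_p := (W_p − 1)·log p / d_p`, we prove: if the crux holds at the prime `q` for every `ε > 0`
(`q^k < C_ε · rad(1·(q^k − 1)·q^k)^{1+ε}` for all `k ≥ 1`), then `c_p → 0` along the primes
(cofinite filter on `Nat.Primes`), i.e. for every `θ > 0` only finitely many primes have
`(W_p − 1) log p ≥ θ · d_p` ("no giant Wieferich primes").

Proof. By the landed `Negative.wieferichSparse_of_PPRAt` the hypothesis gives Wieferich sparsity
`∀ ε₁ > 0 ∃ C > 0 ∀ k ≥ 1, E_W(q,k) < C·q^{ε₁ k}`. Fix `ε > 0`, take `ε₁ := ε / (2 log q)` and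
`Y := ⌈2|log C|/ε⌉ + 1`. A prime `p ∤ q` of order `d_p < Y` divides `N := ∏_{1 ≤ d < Y} (q^d − 1)`
(`atz_prime_le_of_ordMod_lt`), so every prime `p > max (max N q) 2` has `d_p ≥ Y`; moreover
`p^{W_p − 1} ∣ E_W(q, d_p)`, whence `(W_p − 1) log p ≤ log E_W(q,d_p) < log C + ε₁ d_p log q` and
`c_p < log C / d_p + ε/2 ≤ |log C|/Y + ε/2 < ε`. Ported from
`Cruxes/PrimePowerRadical/SketchIdeator2g2.lean` (`prime_le_of_ordMod_lt`,
`atom_tendsto_zero_of_wieferichSparse`) onto the landed `Negative/*` vocabulary, with the atom inlined.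

NOT here: the converse-type lever (`ℓ¹ ⟹` sparsity), the Romanoff expectation theorem, the dial, and the
level-average reformulation — these are the other stubs of the line.
-/

noncomputable section

-- `Summit.<Summit>.<Problem>` is the mandated summit-side namespace (CONVENTIONS §2); for the
-- single-conjunct summit `ABC` the two coincide, so the duplicate `ABC.ABC` is deliberate.
set_option linter.dupNamespace false

namespace Summit.ABC.ABC.Theorems.PrimePowerRadical.Brjuno

open Literature.NumberTheory.DiophantineGeometry UniqueFactorizationMonoid
open Summit.ABC.ABC.Theses.IneffectiveSubspace
open Summit.ABC.ABC.Theorems.PrimePowerRadical.Negative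
open scoped BigOperators

/-- Primes of small multiplicative order are small: a prime `p ∤ q` (`q ≥ 2`) with `ord_p(q) < Y`
divides `∏_{1 ≤ d < Y} (q^d − 1)`, hence is at most this (positive) product. -/
theorem atz_prime_le_of_ordMod_lt {q p Y : ℕ} (hq : 2 ≤ q) (hp : p.Prime) (hpq : ¬ p ∣ q)
    (hY : ordMod q p < Y) : p ≤ ∏ d ∈ Finset.Ico 1 Y, (q ^ d - 1) := by
  have hd : 0 < ordMod q p := ordMod_pos hp hpq
  have hpd : p ∣ q ^ ordMod q p - 1 := (dvd_pow_sub_one_iff_ordMod_dvd hp (by omega) _).mpr dvd_rfl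
  have hmem : ordMod q p ∈ Finset.Ico 1 Y := Finset.mem_Ico.mpr ⟨hd, hY⟩
  have hdvd : p ∣ ∏ d ∈ Finset.Ico 1 Y, (q ^ d - 1) :=
    dvd_trans hpd (Finset.dvd_prod_of_mem _ hmem)
  have hpos : 0 < ∏ d ∈ Finset.Ico 1 Y, (q ^ d - 1) := by
    apply Finset.prod_pos
    intro d hdm
    have hd1 : 1 ≤ d := (Finset.mem_Ico.mp hdm).1
    have := two_le_pow hq hd1
    omega
  exact Nat.le_of_dvd hpos hdvd

/-- The renormalised `p`-adic Brjuno atom `(W_p(q) − 1)·log p / ord_p(q)` is nonnegative. -/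
theorem atz_atom_nonneg (q p : ℕ) :
    0 ≤ ((wieferichLevel q p - 1 : ℕ) : ℝ) * Real.log p / (ordMod q p : ℝ) := by
  apply div_nonneg
  · exact mul_nonneg (Nat.cast_nonneg _) (Real.log_natCast_nonneg p)
  · exact Nat.cast_nonneg _

/-- Wieferich sparsity at the prime `q` (`∀ ε₁ > 0 ∃ C > 0 ∀ k ≥ 1, E_W(q,k) < C·q^{ε₁ k}`) forces the
atoms `(W_p(q) − 1)·log p / ord_p(q)` to tend to `0` along the primes (cofinite filter). -/
theorem atz_atom_tendsto_zero_of_sparse {q : ℕ} (hq : q.Prime)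
    (h : ∀ ε : ℝ, 0 < ε → ∃ C : ℝ, 0 < C ∧ ∀ k : ℕ, 1 ≤ k →
      (oddWieferichExcess q k : ℝ) < C * (q : ℝ) ^ (ε * k)) :
    Filter.Tendsto (fun p : Nat.Primes =>
      ((wieferichLevel q p - 1 : ℕ) : ℝ) * Real.log p / (ordMod q p : ℝ)) Filter.cofinite (nhds 0) := by
  have hq2 := hq.two_le
  have hq0 : (0 : ℝ) < q := by exact_mod_cast hq.pos
  have hq1 : (1 : ℝ) < q := by exact_mod_cast hq.one_lt
  have hlogq : 0 < Real.log q := Real.log_pos hq1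
  rw [Metric.tendsto_nhds]
  intro ε hε
  -- Wieferich sparsity with defect ε₁ = ε / (2 log q)
  set ε₁ : ℝ := ε / (2 * Real.log q) with hε₁
  have hε₁0 : 0 < ε₁ := by positivity
  obtain ⟨C, hC, hCk⟩ := h ε₁ hε₁0
  -- threshold on the order: log C / d < ε/2 once d ≥ Y
  set Y : ℕ := ⌈2 * |Real.log C| / ε⌉₊ + 1 with hY
  set N : ℕ := ∏ d ∈ Finset.Ico 1 Y, (q ^ d - 1) with hN
  -- the exceptional set is contained in {p ≤ max (max N q) 2}
  rw [Filter.eventually_cofinite]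
  apply Set.Finite.subset (s := {p : Nat.Primes | (p : ℕ) ≤ max (max N q) 2})
  · apply Set.Finite.of_finite_image (f := fun p : Nat.Primes => (p : ℕ))
    · apply Set.Finite.subset (Set.finite_Iic (max (max N q) 2))
      rintro n ⟨p, hp, rfl⟩
      exact hp
    · exact Subtype.val_injective.injOn
  · intro p hp
    simp only [Set.mem_setOf_eq, not_lt] at hp
    simp only [Set.mem_setOf_eq]
    -- hp : ε ≤ dist (atom) 0 ; show p small
    have hpr : (p : ℕ).Prime := p.2
    by_contra hbig
    push Not at hbig
    have hp2 : (p : ℕ) ≠ 2 := by omega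
    have hpq' : ¬ (p : ℕ) ∣ q := by
      intro hdvd
      have := Nat.le_of_dvd hq.pos hdvd
      omega
    have hpN : N < (p : ℕ) := by omega
    -- atom ≥ ε
    rw [Real.dist_eq, sub_zero, abs_of_nonneg (atz_atom_nonneg q p)] at hp
    -- name the atom and the order
    set a : ℝ := ((wieferichLevel q p - 1 : ℕ) : ℝ) * Real.log p / (ordMod q p : ℝ) with ha
    set d := ordMod q p with hdd
    have hd : 0 < d := ordMod_pos hpr hpq'
    have hdR : (0 : ℝ) < d := by exact_mod_cast hd
    -- order is large: d ≥ Y (else p ≤ N)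
    have hdY : Y ≤ d := by
      by_contra hlt
      push Not at hlt
      have := atz_prime_le_of_ordMod_lt hq2 hpr hpq' hlt
      omega
    -- from sparsity at k = d:  (W-1) log p ≤ log E_W(q,d) < log C + ε₁ d log q
    have hpd : (p : ℕ) ∣ q ^ d - 1 := (dvd_pow_sub_one_iff_ordMod_dvd hpr (by omega) _).mpr dvd_rfl
    have hmem : (p : ℕ) ∈ (q ^ d - 1).primeFactors.erase 2 := by
      refine Finset.mem_erase.mpr ⟨hp2, ?_⟩
      have hn : q ^ d - 1 ≠ 0 := by have := two_le_pow hq2 hd; omega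
      exact Nat.mem_primeFactors.mpr ⟨hpr, hpd, hn⟩
    have hpowdvd : (p : ℕ) ^ (wieferichLevel q p - 1) ∣ oddWieferichExcess q d := by
      unfold oddWieferichExcess
      exact Finset.dvd_prod_of_mem (fun r => r ^ (wieferichLevel q r - 1)) hmem
    have hE0 : 0 < oddWieferichExcess q d := oddWieferichExcess_pos q d
    have hpowle : (p : ℕ) ^ (wieferichLevel q p - 1) ≤ oddWieferichExcess q d :=
      Nat.le_of_dvd hE0 hpowdvd
    have hEk := hCk d hd
    -- real logs
    have hp0 : (0 : ℝ) < (p : ℕ) := by exact_mod_cast hpr.pos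
    have h1 : ((wieferichLevel q p - 1 : ℕ) : ℝ) * Real.log p ≤ Real.log (oddWieferichExcess q d) := by
      have : Real.log (((p : ℕ) : ℝ) ^ (wieferichLevel q p - 1)) ≤
          Real.log (oddWieferichExcess q d) := by
        apply Real.log_le_log (pow_pos hp0 _)
        exact_mod_cast hpowle
      rwa [Real.log_pow] at this
    have hE0R : (0 : ℝ) < oddWieferichExcess q d := by exact_mod_cast hE0
    have h2 : Real.log (oddWieferichExcess q d) < Real.log C + ε₁ * d * Real.log q := by
      have := Real.log_lt_log hE0R hEk
      rw [Real.log_mul hC.ne' (Real.rpow_pos_of_pos hq0 _).ne', Real.log_rpow hq0] at this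
      linarith
    -- atom = (W-1) log p / d < log C / d + ε₁ log q ≤ |log C| / Y + ε/2 < ε
    have h3 : a * d < Real.log C + ε₁ * d * Real.log q := by
      have : a * d = ((wieferichLevel q p - 1 : ℕ) : ℝ) * Real.log p := by
        rw [ha, div_mul_cancel₀ _ hdR.ne']
      rw [this]; linarith
    have h4 : a < Real.log C / d + ε₁ * Real.log q := by
      have key : a * d < (Real.log C / d + ε₁ * Real.log q) * d := by
        -- (explicit numerator: the pattern `_ / d * d` must not unfold the local `a`)
        rw [add_mul, div_mul_cancel₀ (Real.log C) hdR.ne']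
        have e : ε₁ * (d : ℝ) * Real.log q = ε₁ * Real.log q * d := by ring
        linarith [h3, e]
      exact lt_of_mul_lt_mul_right key hdR.le
    have h5 : ε₁ * Real.log q = ε / 2 := by
      rw [hε₁]; field_simp
    have hYR : (0 : ℝ) < Y := by exact_mod_cast (show 0 < Y by omega)
    have h6 : Real.log C / d ≤ |Real.log C| / Y := by
      have hdY' : (Y : ℝ) ≤ d := by exact_mod_cast hdY
      calc Real.log C / d ≤ |Real.log C| / d := by
            apply div_le_div_of_nonneg_right (le_abs_self _) hdR.le
        _ ≤ |Real.log C| / Y := by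
            apply div_le_div_of_nonneg_left (abs_nonneg _) hYR hdY'
    have h7 : |Real.log C| / Y < ε / 2 := by
      rw [div_lt_iff₀ hYR]
      have hc1 : 2 * |Real.log C| / ε ≤ ⌈2 * |Real.log C| / ε⌉₊ := Nat.le_ceil _
      have hc2 : (⌈2 * |Real.log C| / ε⌉₊ : ℝ) < Y := by
        rw [hY]; push_cast; linarith
      have hc3 : 2 * |Real.log C| / ε < Y := lt_of_le_of_lt hc1 hc2
      rw [div_lt_iff₀ hε] at hc3
      linarith
    linarith

/-- **stub_atom_tendsto_zero (NECESSARY direction of the sandwich).** The crux at the prime `q`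
(`∀ ε > 0 ∃ C > 0 ∀ k ≥ 1, q^k < C · rad(1·(q^k − 1)·q^k)^{1+ε}`) forces the renormalised Brjuno atoms
`c_p = (W_p(q) − 1)·log p / ord_p(q)` to tend to `0` along the primes (cofinite filter): equivalently, for
every `θ > 0` only finitely many primes have `(W_p − 1) log p ≥ θ · ord_p(q)` ("no giant Wieferich primes"). -/
theorem stub_atom_tendsto_zero {q : ℕ} (hq : q.Prime)
    (h : ∀ ε : ℝ, 0 < ε → ∃ C : ℝ, 0 < C ∧ ∀ k : ℕ, 1 ≤ k →
      ((q ^ k : ℕ) : ℝ) < C * ((rad 1 (q ^ k - 1) (q ^ k) : ℕ) : ℝ) ^ (1 + ε)) :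
    Filter.Tendsto (fun p : Nat.Primes =>
      ((wieferichLevel q p - 1 : ℕ) : ℝ) * Real.log p / (ordMod q p : ℝ)) Filter.cofinite (nhds 0) :=
  atz_atom_tendsto_zero_of_sparse hq (wieferichSparse_of_PPRAt hq h)

end Summit.ABC.ABC.Theorems.PrimePowerRadical.Brjuno

end
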